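import Mathlib
import Summits.NavierStokesRegularity.NavierStokesRegularity.Theorems.ThreadingFluxCentreJetDefs
import Summits.NavierStokesRegularity.NavierStokesRegularity.Theorems.ThreadingFluxCentreJetPoloidalRepresentation
import HarnessLib

/-!
# Crux `PoloidalLiouville` (stmt-NavierStokesRegularity-1222, wall W1), crux idea «steady-centre-sieve» (ns-idea-15 g5):
# `PoloidalRepresentation` (E4) of `ThreadingFluxCentreJetDefs.lean` BY NAME

Support file (Theorems-side glue; seat ns-wall-eng-7 g5, cell ns-wall-extremal, W1 adjunct; `--supports
stmt-NavierStokesRegularity-1222 --as helper`).  One-line η-wrapper of the verbatim-body kernel theorem `CentreJet.poloidalRepresentation`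
(p684874) over the (appended, v4) Theorems-side Defs twin: `poloidalRepresentation_holds : PoloidalRepresentation`.  Companion of
`ThreadingFluxCentreJetByName.lean` (E1, E3, R3, sanity) and `ThreadingFluxCentreJetByName2.lean` (E2, E2′, E5): with it every S-marked
statement of the card is a theorem BY NAME Theorems-side.

HONEST LABEL: information-grade S-lemma of an idea card; the card's conjectures and target, `PoloidalLiouville` (1222) and NS regularity
remain OPEN and untouched.  [cite: Spivak1965, Thm. 4-11]
-/

-- the summit and its single problem share the name (D-0017 nested layout)
set_option linter.dupNamespace false

noncomputable section

namespace Summit.NavierStokesRegularity.NavierStokesRegularity.Theorems.PoloidalLiouville.CentreJet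

/-- ★ **(E4) `PoloidalRepresentation` BY NAME.** -/
theorem poloidalRepresentation_holds : PoloidalRepresentation :=
  fun V T x₀ hV hdiv hT hcurl => poloidalRepresentation V T x₀ hV hdiv hT hcurl

end Summit.NavierStokesRegularity.NavierStokesRegularity.Theorems.PoloidalLiouville.CentreJet

end
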